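import Summits.Ventures.PercRepro.RankLevelSetHallRuleQ

/-!
# PercRepro — Rule Q at the tight layer: THE SWAP COUNT `m(S) ≤ m̂` (night-1, gen 13; step (D) of dossier §23.8)

For a member `Z` at the tight layer and `X_P ⊆ P = flatPart`, `X_D ⊆ D = freePart`, every member `Z′` inside
`S = Z ∪ X_P ∪ X_D` is the swap `Z′ = (Z ∖ Y₁) ∪ Y₂^P ∪ Y₂^D` with `Y₁ = Z ∖ Z′`, `Y₂^P = Z′ ∩ X_P`, `Y₂^D = Z′ ∩ X_D`,
`#Y₁ = #Y₂^P + #Y₂^D` and `#Y₂^D ≤ q − #P` (the co-independence lemma).  Counting the triples: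
`memCount M p q S ≤ mhat q #P #X_P #X_D := Σ_{t_P ≤ #X_P} Σ_{t_D ≤ min(#X_D, q − #P)} C(q, t_P+t_D)·C(#X_P, t_P)·C(#X_D, t_D)`.

* `ncard_eq_of_mem_cellMembers` — a member at the tight layer has exactly `q` elements;
* `mhat` — the swap-count bound `m̂(q, m; a, j)`;
* `swapTriples`, `ncard_swapTriples_le` — the triples `(Y₁, Y₂^P, Y₂^D)` and their count;
* **`memCount_le_swapSum`** — the swap count with the bound `b` on `#(Z′ ∩ X_D)` taken as a hypothesis; with
  `b = q − #P` from `ncard_inter_freePart_add_ncard_flatPart_le` (RankLevelSetRuleQSwap) the right side is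
  `mhat q #P #X_P #X_D` — that instantiation (`memCount_le_mhat`) is the next module, on the Swap olean.
Axioms: standard.
-/

namespace PercRepro

open Set Matroid Finset

variable {α : Type} (M : Matroid α) [M.Finite]

/-- A member of the cell `(p, q)` at the tight layer `#E = p + q` has exactly `q` elements. -/
lemma ncard_eq_of_mem_cellMembers {p q : ℕ} (hE : M.E.ncard = p + q) {Z : Set α} (hZ : Z ∈ cellMembers M p q) :
    Z.ncard = q := by
  obtain ⟨-, hcard⟩ := compl_indep_of_mem_U M hE hZ
  have h := ncard_sdiff_add_ncard_of_subset hZ.1 M.ground_finite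
  rw [hcard, hE] at h
  omega

/-- The swap-count bound `m̂(q, m; a, j)`. -/
def mhat (q m a j : ℕ) : ℕ :=
  ∑ tP ∈ Finset.range (a + 1), ∑ tD ∈ Finset.range (min j (q - m) + 1),
    q.choose (tP + tD) * a.choose tP * j.choose tD

/-- The swap triples: `(Y₁, Y₂^P, Y₂^D)` with `Y₁ ⊆ Z`, `Y₂^P ⊆ X_P`, `Y₂^D ⊆ X_D`, `#Y₁ = #Y₂^P + #Y₂^D`, `#Y₂^D ≤ b`. -/
def swapTriples (Z XP XD : Set α) (b : ℕ) : Set ((Set α × Set α) × Set α) :=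
  {t | t.1.1 ⊆ Z ∧ t.1.2 ⊆ XP ∧ t.2 ⊆ XD ∧ t.1.1.ncard = t.1.2.ncard + t.2.ncard ∧ t.2.ncard ≤ b}

omit [M.Finite] in
/-- The swap triples of finite sets number at most `m̂`. -/
lemma ncard_swapTriples_le {Z XP XD : Set α} (hZ : Z.Finite) (hXP : XP.Finite) (hXD : XD.Finite) (q b : ℕ)
    (hq : Z.ncard = q) :
    (swapTriples Z XP XD b).ncard ≤
      ∑ tP ∈ Finset.range (XP.ncard + 1), ∑ tD ∈ Finset.range (min XD.ncard b + 1),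
        q.choose (tP + tD) * XP.ncard.choose tP * XD.ncard.choose tD := by
  classical
  set Zf := hZ.toFinset with hZf
  set XPf := hXP.toFinset with hXPf
  set XDf := hXD.toFinset with hXDf
  -- the finset of triples, indexed by the sizes
  set T : Finset ((Finset α × Finset α) × Finset α) :=
    (Finset.range (XP.ncard + 1)).biUnion (fun tP => (Finset.range (min XD.ncard b + 1)).biUnion (fun tD =>
      (Zf.powersetCard (tP + tD) ×ˢ XPf.powersetCard tP) ×ˢ XDf.powersetCard tD)) with hT
  have hTcard : T.card ≤ ∑ tP ∈ Finset.range (XP.ncard + 1), ∑ tD ∈ Finset.range (min XD.ncard b + 1),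
      q.choose (tP + tD) * XP.ncard.choose tP * XD.ncard.choose tD := by
    rw [hT]
    refine (Finset.card_biUnion_le).trans (Finset.sum_le_sum (fun tP _ => ?_))
    refine (Finset.card_biUnion_le).trans (Finset.sum_le_sum (fun tD _ => ?_))
    rw [Finset.card_product, Finset.card_product, Finset.card_powersetCard, Finset.card_powersetCard,
      Finset.card_powersetCard, hZf, hXPf, hXDf, ← ncard_eq_toFinset_card _ hZ, ← ncard_eq_toFinset_card _ hXP,
      ← ncard_eq_toFinset_card _ hXD, hq]
  -- every swap triple is the coercion of an element of T
  set φ : (Finset α × Finset α) × Finset α → (Set α × Set α) × Set α :=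
    fun t => ((↑t.1.1, ↑t.1.2), ↑t.2) with hφ
  have hsub : swapTriples Z XP XD b ⊆ ((T.image φ : Finset _) : Set _) := by
    rintro ⟨⟨Y1, YP⟩, YD⟩ ⟨h1, h2, h3, h4, h5⟩
    simp only at h1 h2 h3 h4 h5
    have hY1 : Y1.Finite := hZ.subset h1
    have hYP : YP.Finite := hXP.subset h2
    have hYD : YD.Finite := hXD.subset h3
    rw [Finset.coe_image]
    refine ⟨((hY1.toFinset, hYP.toFinset), hYD.toFinset), ?_, ?_⟩
    · rw [Finset.mem_coe, hT, Finset.mem_biUnion]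
      refine ⟨YP.ncard, ?_, ?_⟩
      · rw [Finset.mem_range]
        have := ncard_le_ncard h2 hXP
        omega
      rw [Finset.mem_biUnion]
      refine ⟨YD.ncard, ?_, ?_⟩
      · rw [Finset.mem_range]
        have := ncard_le_ncard h3 hXD
        omega
      refine Finset.mem_product.2 ⟨Finset.mem_product.2 ⟨?_, ?_⟩, ?_⟩
      · rw [Finset.mem_powersetCard, hZf, Finite.toFinset_subset_toFinset, ← ncard_eq_toFinset_card _ hY1]
        exact ⟨h1, h4⟩
      · rw [Finset.mem_powersetCard, hXPf, Finite.toFinset_subset_toFinset, ← ncard_eq_toFinset_card _ hYP]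
        exact ⟨h2, rfl⟩
      · rw [Finset.mem_powersetCard, hXDf, Finite.toFinset_subset_toFinset, ← ncard_eq_toFinset_card _ hYD]
        exact ⟨h3, rfl⟩
    · simp [hφ, hY1.coe_toFinset, hYP.coe_toFinset, hYD.coe_toFinset]
  calc (swapTriples Z XP XD b).ncard ≤ ((T.image φ : Finset _) : Set _).ncard :=
        ncard_le_ncard hsub (Finset.finite_toSet _)
    _ = (T.image φ).card := ncard_coe_finset _
    _ ≤ T.card := Finset.card_image_le
    _ ≤ _ := hTcard

/-- **The swap count, with the co-independence bound as a hypothesis**: for a member `Z` at the tight layer,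
`X_P ⊆ (E ∖ Z) ∩ cl Z`, `X_D ⊆ (E ∖ Z) ∖ cl Z`, and `b` a bound on `#(Z′ ∩ X_D)` over the members `Z′`,
`memCount M p q (Z ∪ X_P ∪ X_D) ≤ Σ_{t_P ≤ #X_P} Σ_{t_D ≤ min(#X_D, b)} C(q, t_P+t_D)·C(#X_P,t_P)·C(#X_D,t_D)`. -/
theorem memCount_le_swapSum {p q : ℕ} (hE : M.E.ncard = p + q) {Z : Set α} (hZ : Z ∈ cellMembers M p q)
    {XP XD : Set α} (hXP : XP ⊆ (M.E \ Z) ∩ M.closure Z) (hXD : XD ⊆ (M.E \ Z) \ M.closure Z) (b : ℕ)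
    (hco : ∀ Z' ∈ cellMembers M p q, (Z' ∩ XD).ncard ≤ b) :
    memCount M p q (Z ∪ XP ∪ XD) ≤
      ∑ tP ∈ Finset.range (XP.ncard + 1), ∑ tD ∈ Finset.range (min XD.ncard b + 1),
        q.choose (tP + tD) * XP.ncard.choose tP * XD.ncard.choose tD := by
  classical
  have hZfin : Z.Finite := M.ground_finite.subset hZ.1
  have hXPfin : XP.Finite := M.ground_finite.subset (fun x hx => (hXP hx).1.1)
  have hXDfin : XD.Finite := M.ground_finite.subset (fun x hx => (hXD hx).1.1)
  have hq : Z.ncard = q := ncard_eq_of_mem_cellMembers M hE hZ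
  -- disjointness of the three parts
  have hZXP : Disjoint Z XP := Set.disjoint_left.2 (fun x hx hx' => (hXP hx').1.2 hx)
  have hZXD : Disjoint Z XD := Set.disjoint_left.2 (fun x hx hx' => (hXD hx').1.2 hx)
  have hXPXD : Disjoint XP XD := Set.disjoint_left.2 (fun x hx hx' => (hXD hx').2 (hXP hx).2)
  -- the injection Z′ ↦ (Z ∖ Z′, Z′ ∩ X_P, Z′ ∩ X_D)
  set ψ : Set α → (Set α × Set α) × Set α := fun Z' => ((Z \ Z', Z' ∩ XP), Z' ∩ XD) with hψ
  have hTfin : (swapTriples Z XP XD b).Finite := by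
    refine ((hZfin.finite_subsets.prod hXPfin.finite_subsets).prod hXDfin.finite_subsets).subset ?_
    rintro ⟨⟨Y1, YP⟩, YD⟩ ⟨h1, h2, h3, -, -⟩
    exact ⟨⟨h1, h2⟩, h3⟩
  have hdecomp : ∀ Z' ∈ cellMembers M p q, Z' ⊆ Z ∪ XP ∪ XD →
      Z' = (Z' ∩ Z) ∪ (Z' ∩ XP) ∪ (Z' ∩ XD) := by
    intro Z' _ hsub
    ext x
    constructor
    · intro hx
      rcases hsub hx with (hz | hp) | hd
      · exact Or.inl (Or.inl ⟨hx, hz⟩)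
      · exact Or.inl (Or.inr ⟨hx, hp⟩)
      · exact Or.inr ⟨hx, hd⟩
    · rintro ((h | h) | h) <;> exact h.1
  have hmaps : ∀ Z' ∈ {Z' | Z' ∈ cellMembers M p q ∧ Z' ⊆ Z ∪ XP ∪ XD}, ψ Z' ∈ swapTriples Z XP XD b := by
    rintro Z' ⟨hZ', hsub⟩
    refine ⟨Set.sdiff_subset, Set.inter_subset_right, Set.inter_subset_right, ?_, hco Z' hZ'⟩
    show (Z \ Z').ncard = (Z' ∩ XP).ncard + (Z' ∩ XD).ncard
    have hq' : Z'.ncard = q := ncard_eq_of_mem_cellMembers M hE hZ'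
    have hZ'fin : Z'.Finite := M.ground_finite.subset hZ'.1
    -- #Z′ = #(Z′ ∩ Z) + #(Z′ ∩ X_P) + #(Z′ ∩ X_D)
    have hsplit : Z'.ncard = (Z' ∩ Z).ncard + (Z' ∩ XP).ncard + (Z' ∩ XD).ncard := by
      conv_lhs => rw [hdecomp Z' hZ' hsub]
      rw [ncard_union_eq ?_ ((hZ'fin.inter_of_left _).union (hZ'fin.inter_of_left _)) (hZ'fin.inter_of_left _),
        ncard_union_eq ?_ (hZ'fin.inter_of_left _) (hZ'fin.inter_of_left _)]
      · exact hZXP.mono Set.inter_subset_right Set.inter_subset_right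
      · exact Set.disjoint_union_left.2 ⟨(hZXD.mono Set.inter_subset_right Set.inter_subset_right),
          (hXPXD.mono Set.inter_subset_right Set.inter_subset_right)⟩
    -- #Z = #(Z ∩ Z′) + #(Z ∖ Z′)
    have hZsplit := ncard_inter_add_ncard_sdiff_eq_ncard Z Z' hZfin
    rw [Set.inter_comm] at hZsplit
    omega
  have hinj : Set.InjOn ψ {Z' | Z' ∈ cellMembers M p q ∧ Z' ⊆ Z ∪ XP ∪ XD} := by
    rintro Z₁ ⟨hZ₁, hs₁⟩ Z₂ ⟨hZ₂, hs₂⟩ hEq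
    simp only [hψ, Prod.mk.injEq] at hEq
    obtain ⟨⟨e1, e2⟩, e3⟩ := hEq
    have e1' : Z₁ ∩ Z = Z₂ ∩ Z := by
      have := congrArg (fun T => Z \ T) e1
      simp only [Set.sdiff_sdiff_right_self] at this
      rw [Set.inter_comm Z₁, Set.inter_comm Z₂]
      exact this
    rw [hdecomp Z₁ hZ₁ hs₁, hdecomp Z₂ hZ₂ hs₂, e1', e2, e3]
  have hle : memCount M p q (Z ∪ XP ∪ XD) ≤ (swapTriples Z XP XD b).ncard :=
    ncard_le_ncard_of_injOn ψ hmaps hinj hTfin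
  exact hle.trans (ncard_swapTriples_le hZfin hXPfin hXDfin q b hq)

end PercRepro
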